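import Summits.CriticalPhenomena.Ising3DConformalLimit.Theorems.PlantedPinningGaussianPinningSaturationDefs
import Literature.Probability.LatticeModels.IsingConsistency

/-!
# Uniform positive-definiteness of the critical `+` box covariance (stub `stub_covUniformPD`)

Stub `stub_covUniformPD` of the line `birth` (linear-benchmark split) for the crux
`GaussianPinningSaturation` (item stmt-CriticalPhenomena-8452; objects in
`…GaussianPinningSaturationDefs`): an analytic input of the open leaf B2 (torsion principle for the
precision form `⟨f, (cov_L)⁻¹ f⟩`, which needs `λ_min(cov_L) ≥ c > 0` uniformly in `L`).

**Statement** (`stub_covUniformPD`, registered signature verbatim). There is `c > 0` such that for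
every `L` and every `f : Λ_L → ℝ` (`Λ_L = box 3 L`), `c Σ_a f(a)² ≤ Σ_{a,b} f(a) K_L(a,b) f(b)`
with `K_L = covMat L Λ_L = (Cov⁺_{Λ_L;β_c(3),0}(σ_a,σ_b))_{a,b}`. We get `c = e^{-12 β_c(3)}/2`.

**Proof** (uniform non-degeneracy by conditioning on a sublattice, folklore; all inputs are finite
Boltzmann sums of `Literature.Probability.LatticeModels`).
* `fᵀ K_L f = Var⁺_L(F)`, `F = Σ_a f(a) σ_a` (pattern-level algebra, as in the torsion file).
* `ℤ³` is bipartite (parity of `x₀+x₁+x₂`, `zdGraph_adj_iff`): the even and the odd sites of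
  `Λ_L` are independent sets `E`.
* DLR in two steps (`sum_isingWeight_fixed_eq_sum_sum`, Friedli–Velenik 2017, Lemma 6.7): summing
  first over the spins off `E` (which update the boundary condition to `η₂`) and then over the
  spins of `E`, `Z·Var⁺_L(F) = Σ_{τ₂} R(τ₂) Σ_{τ₁} w^{η₂}_E(τ₁) (F − ⟨F⟩)²`, and each inner mean
  square dominates the variance of `F` under `μ^{η₂}_E` (law of total variance).
* Under `μ^{η}_E`, `E` independent, the spins of `E` are pairwise uncorrelated with single-site
  marginals (`isingExpect_fixed_mul_of_separated`, `isingExpect_fixed_eq_of_separated`;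
  Friedli–Velenik 2017, Exercise 3.15) and the spins off `E` are frozen, so
  `Var^{η}_E(F) = Σ_{a ∈ E} f(a)² Var^{η}_{{a}}(σ_a)`.
* Single site in `ℤ³`: `|ℋ_{{a}}| ≤ 6` (six incident edges, `card_neighborFinset_zdGraph_holds`),
  so both Boltzmann weights lie in `[e^{-6β}, e^{6β}]` and `⟨(σ_a − m)²⟩^{η}_{{a}} ≥ e^{-12β}`
  for every real `m` (symmetrisation `τ ↦ −τ`).
* Summing back (`isingPartitionFunction_fixed_eq_sum`): `Var⁺_L(F) ≥ e^{-12β} Σ_{a ∈ E} f(a)²`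
  for `E` = even sites and `E` = odd sites; average the two bounds.

References: S. Friedli, Y. Velenik, *Statistical Mechanics of Lattice Systems* (CUP 2017), §3.1,
Lemma 6.7, Exercise 3.15; R. L. Dobrushin, S. B. Shlosman, in *Statistical Physics and Dynamical
Systems* (Birkhäuser 1985), 347–370 (conditioning on a sublattice).
-/

noncomputable section

namespace Summit.CriticalPhenomena.Ising3DConformalLimit.PlantedPinningGaussianPinningSaturation

open scoped BigOperators Classical
open Finset MeasureTheory Matrix
open Literature.Probability.LatticeModels
open Summit.CriticalPhenomena.Ising3DConformalLimit.Theses.PlantedPinning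

/-! ### Finite weighted sums: the quadratic form of a covariance and the law of total variance -/

section Abstract

variable {V Ω : Type*} [Fintype Ω]

/-- Pure algebra: the weighted second moment of a linear statistic is the quadratic form of the
matrix of weighted mixed moments. [folklore] -/
private theorem wsum_sq_lin (p : Ω → ℝ) (Λ : Finset V) (f : V → ℝ) (u : V → Ω → ℝ) :
    ∑ ω, p ω * (∑ a ∈ Λ, f a * u a ω) ^ 2 =
      ∑ a ∈ Λ, ∑ b ∈ Λ, f a * f b * ∑ ω, p ω * (u a ω * u b ω) := by
  have h : ∀ ω, p ω * (∑ a ∈ Λ, f a * u a ω) ^ 2 =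
      ∑ a ∈ Λ, ∑ b ∈ Λ, f a * f b * (p ω * (u a ω * u b ω)) := fun ω => by
    rw [sq, Finset.sum_mul_sum, Finset.mul_sum]
    refine Finset.sum_congr rfl fun a _ => ?_
    rw [Finset.mul_sum]
    exact Finset.sum_congr rfl fun b _ => by ring
  rw [Finset.sum_congr rfl fun ω _ => h ω, Finset.sum_comm]
  refine Finset.sum_congr rfl fun a _ => ?_
  rw [Finset.sum_comm]
  exact Finset.sum_congr rfl fun b _ => by rw [Finset.mul_sum]

/-- If the off-diagonal weighted mixed moments of the `u_a` vanish and the diagonal ones on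
`E ⊆ Λ` are at least `ρ`, then `Σ_ω p (Σ_a f_a u_a)² ≥ ρ Σ_{a ∈ E} f_a²` (`p ≥ 0`). [folklore] -/
private theorem wsum_sq_lin_ge {p : Ω → ℝ} (hp : ∀ ω, 0 ≤ p ω) {Λ E : Finset V} (hE : E ⊆ Λ)
    (f : V → ℝ) (u : V → Ω → ℝ) {ρ : ℝ}
    (hoff : ∀ a ∈ Λ, ∀ b ∈ Λ, a ≠ b → ∑ ω, p ω * (u a ω * u b ω) = 0)
    (hdiag : ∀ a ∈ E, ρ ≤ ∑ ω, p ω * (u a ω * u a ω)) :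
    ρ * ∑ a ∈ E, f a ^ 2 ≤ ∑ ω, p ω * (∑ a ∈ Λ, f a * u a ω) ^ 2 := by
  rw [wsum_sq_lin]
  have hd : ∑ a ∈ Λ, ∑ b ∈ Λ, f a * f b * ∑ ω, p ω * (u a ω * u b ω) =
      ∑ a ∈ Λ, f a * f a * ∑ ω, p ω * (u a ω * u a ω) := by
    refine Finset.sum_congr rfl fun a ha => ?_
    rw [Finset.sum_eq_single_of_mem a ha]
    exact fun b hb hba => by rw [hoff a ha b hb (Ne.symm hba), mul_zero]
  rw [hd, Finset.mul_sum]
  calc ∑ a ∈ E, ρ * f a ^ 2 ≤ ∑ a ∈ E, f a * f a * ∑ ω, p ω * (u a ω * u a ω) := by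
        refine Finset.sum_le_sum fun a ha => ?_
        rw [sq, mul_comm]
        exact mul_le_mul_of_nonneg_left (hdiag a ha) (mul_self_nonneg (f a))
    _ ≤ ∑ a ∈ Λ, f a * f a * ∑ ω, p ω * (u a ω * u a ω) :=
        Finset.sum_le_sum_of_subset_of_nonneg hE fun a _ _ => mul_nonneg (mul_self_nonneg _)
          (Finset.sum_nonneg fun ω _ => mul_nonneg (hp ω) (mul_self_nonneg _))

/-- The weighted mean square about any constant dominates the weighted variance (`Σ p = 1`):
`Σ p (Y − C)² = Σ p (Y − Ȳ)² + (Ȳ − C)²`. [folklore] -/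
private theorem wvar_le_wmse {p : Ω → ℝ} (hp1 : ∑ ω, p ω = 1) (Y : Ω → ℝ) (C : ℝ) :
    ∑ ω, p ω * (Y ω - ∑ ω', p ω' * Y ω') ^ 2 ≤ ∑ ω, p ω * (Y ω - C) ^ 2 := by
  set Yb := ∑ ω', p ω' * Y ω' with hYb
  have h : ∀ ω, p ω * (Y ω - C) ^ 2 = p ω * (Y ω - Yb) ^ 2 + 2 * (Yb - C) * (p ω * Y ω)
      + ((Yb - C) ^ 2 - 2 * (Yb - C) * Yb) * p ω := fun ω => by ring
  have hsum : ∑ ω, p ω * (Y ω - C) ^ 2 = ∑ ω, p ω * (Y ω - Yb) ^ 2 + (Yb - C) ^ 2 := by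
    rw [Finset.sum_congr rfl fun ω _ => h ω, Finset.sum_add_distrib, Finset.sum_add_distrib,
      ← Finset.mul_sum, ← Finset.mul_sum, hp1, ← hYb]
    ring
  rw [hsum]
  nlinarith [sq_nonneg (Yb - C)]

end Abstract

/-! ### The lattice `ℤ³`: bipartiteness and the single-site Gibbs measure -/

/-- `ℤ³` is bipartite by the parity of the coordinate sum: neighbours have opposite parities
(`zdGraph_adj_iff`: neighbours differ by a unit coordinate vector). [folklore] -/
private theorem even_iff_not_even_of_adj {x y : Site 3} (h : (zdGraph 3).Adj x y) :
    (Even (∑ i, x i) ↔ ¬Even (∑ i, y i)) := by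
  have hstep : ∀ (u : Site 3) (i : Fin 3), ∑ j, (u + Pi.single i 1 : Site 3) j = ∑ j, u j + 1 :=
    fun u i => by simp [Finset.sum_add_distrib, Finset.sum_pi_single']
  rw [zdGraph_adj_iff] at h
  obtain ⟨i, h | h⟩ := h
  · rw [h, hstep, Int.even_add_one, not_not]
  · rw [h, hstep, Int.even_add_one]

/-- In `ℤ³` the single-site Hamiltonian with a fixed boundary condition and `h = 0` is bounded by
the number `6` of incident edges (`card_neighborFinset_zdGraph_holds`; `|σ_e| = 1`). [folklore] -/
private theorem abs_isingHamiltonian_singleton_le (a : Site 3) (η σ : SpinConfig (Site 3)) :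
    |isingHamiltonian (zdGraph 3) {a} 0 (.fixed η) σ| ≤ 6 := by
  have hE : edgesTouching (zdGraph 3) ({a} : Finset (Site 3)) = (zdGraph 3).incidenceFinset a := by
    simp only [edgesTouching, Finset.singleton_biUnion]
  have hcard : ((zdGraph 3).incidenceFinset a).card = 6 := by
    rw [SimpleGraph.card_incidenceFinset_eq_degree, ← SimpleGraph.card_neighborFinset_eq_degree]
    exact card_neighborFinset_zdGraph_holds a
  have hb : ∀ e : Sym2 (Site 3), |bondSpin σ e| = 1 := fun e => by
    induction e using Sym2.ind with
    | _ x y => rw [bondSpin_mk, abs_mul, abs_spinAt, abs_spinAt, mul_one]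
  have h1 : |∑ e ∈ (zdGraph 3).incidenceFinset a, bondSpin σ e| ≤ 6 :=
    calc |∑ e ∈ (zdGraph 3).incidenceFinset a, bondSpin σ e|
          ≤ ∑ e ∈ (zdGraph 3).incidenceFinset a, |bondSpin σ e| := Finset.abs_sum_le_sum_abs _ _
      _ = 6 := by rw [Finset.sum_congr rfl fun e _ => hb e, Finset.sum_const, hcard]; norm_num
  simpa only [isingHamiltonian, interactionEdges_fixed, zero_mul, sub_zero, abs_neg, hE] using h1

/-- **Single-site non-degeneracy**: for the one-site Gibbs measure `μ^{η}_{{a};β,0}` on `ℤ³`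
(`β ≥ 0`, any boundary condition `η`) and every real `m`, `⟨(σ_a − m)²⟩ ≥ e^{-12β}`: the two
Boltzmann weights lie in `[e^{-6β}, e^{6β}]`, and `Σ_τ (σ_a(τ) − m)² = Σ_τ (1 + m²)` by the
symmetrisation `τ ↦ −τ`. [folklore] -/
private theorem exp_le_isingExpect_singleton_sq {β : ℝ} (hβ : 0 ≤ β) (a : Site 3)
    (η : SpinConfig (Site 3)) (m : ℝ) :
    Real.exp (-(12 * β)) ≤
      isingExpect (zdGraph 3) {a} β 0 (.fixed η) (fun σ => (spinAt a σ - m) ^ 2) := by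
  have hmeas : Measurable fun σ : SpinConfig (Site 3) => (spinAt a σ - m) ^ 2 :=
    ((measurable_spinAt a).sub_const m).pow_const 2
  have hZpos := isingPartitionFunction_pos (zdGraph 3) {a} β 0 (.fixed η)
  rw [isingExpect_eq_sum_div (zdGraph 3) {a} 0 (.fixed η) β hmeas, le_div_iff₀ hZpos]
  set w : (↥({a} : Finset (Site 3)) → ℤˣ) → ℝ := isingWeight (zdGraph 3) {a} β 0 (.fixed η) with hw
  set s : (↥({a} : Finset (Site 3)) → ℤˣ) → ℝ := fun τ => spinAt a (glue {a} τ (.fixed η)) with hs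
  set N : ℝ := ((Finset.univ : Finset (↥({a} : Finset (Site 3)) → ℤˣ)).card : ℝ) with hN
  -- the two-sided bound on the weights
  have hwb : ∀ τ, Real.exp (-(6 * β)) ≤ w τ ∧ w τ ≤ Real.exp (6 * β) := fun τ => by
    have h := abs_le.1 (abs_isingHamiltonian_singleton_le a η (glue {a} τ (.fixed η)))
    simp only [hw, isingWeight]; constructor <;> apply Real.exp_le_exp.2 <;> nlinarith [h.1, h.2]
  -- symmetrisation of the unweighted sum: `Σ_τ (σ_a − m)² ≥ N`, `N` the number of patterns
  have hsneg : ∀ τ, s (-τ) = -s τ := fun τ => by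
    simp [hs, spinAt, Finset.mem_singleton_self a, Units.val_neg]
  have hre : ∑ τ, (s τ - m) ^ 2 = ∑ τ, (s τ + m) ^ 2 :=
    Fintype.sum_equiv (Equiv.neg _) _ _ fun τ => by rw [Equiv.neg_apply, hsneg]; ring
  have h2 : ∑ τ, (s τ - m) ^ 2 + ∑ τ, (s τ + m) ^ 2 = N * (2 + 2 * m ^ 2) := by
    rw [← Finset.sum_add_distrib, hN, ← nsmul_eq_mul, ← Finset.sum_const]
    exact Finset.sum_congr rfl fun τ _ => by linear_combination (2 : ℝ) * spinAt_sq a _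
  have hi : N ≤ ∑ τ, (s τ - m) ^ 2 := by
    nlinarith [hre, h2, sq_nonneg m, (Nat.cast_nonneg _ : (0 : ℝ) ≤ N)]
  -- the partition function from above, the weighted sum from below
  have hii : isingPartitionFunction (zdGraph 3) {a} β 0 (.fixed η) ≤ N * Real.exp (6 * β) :=
    calc isingPartitionFunction (zdGraph 3) {a} β 0 (.fixed η) = ∑ τ, w τ := rfl
      _ ≤ ∑ _τ : ↥({a} : Finset (Site 3)) → ℤˣ, Real.exp (6 * β) :=
          Finset.sum_le_sum fun τ _ => (hwb τ).2
      _ = N * Real.exp (6 * β) := by rw [Finset.sum_const, nsmul_eq_mul, hN]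
  have hiii : Real.exp (-(6 * β)) * N ≤ ∑ τ, w τ * (s τ - m) ^ 2 :=
    calc Real.exp (-(6 * β)) * N ≤ Real.exp (-(6 * β)) * ∑ τ, (s τ - m) ^ 2 :=
          mul_le_mul_of_nonneg_left hi (Real.exp_pos _).le
      _ = ∑ τ, Real.exp (-(6 * β)) * (s τ - m) ^ 2 := Finset.mul_sum _ _ _
      _ ≤ ∑ τ, w τ * (s τ - m) ^ 2 :=
          Finset.sum_le_sum fun τ _ => mul_le_mul_of_nonneg_right (hwb τ).1 (sq_nonneg _)
  have hρ : Real.exp (-(12 * β)) * Real.exp (6 * β) = Real.exp (-(6 * β)) := by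
    rw [← Real.exp_add]; congr 1; ring
  calc Real.exp (-(12 * β)) * isingPartitionFunction (zdGraph 3) {a} β 0 (.fixed η)
        ≤ Real.exp (-(12 * β)) * (N * Real.exp (6 * β)) :=
        mul_le_mul_of_nonneg_left hii (Real.exp_pos _).le
    _ = Real.exp (-(6 * β)) * N := by rw [← hρ]; ring
    _ ≤ ∑ τ, w τ * (s τ - m) ^ 2 := hiii

/-! ### Conditional variance on an independent set with a fixed boundary condition -/

/-- **Variance of a linear statistic under `μ^{η}_{E;β,0}` for an independent set `E` of `ℤ³`.**
For `E ⊆ Λ` with no edge of `ℤ³` inside `E`, any boundary condition `η`, `β ≥ 0`, `f` and `C`: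
`e^{-12β} (Σ_{a ∈ E} f(a)²) Z^{η}_E ≤ Σ_τ w^{η}_E(τ) (Σ_{a ∈ Λ} f(a) σ_a(τ∨η) − C)²`. The mean
square about `C` dominates the variance; the spins of `E` are pairwise uncorrelated with one-site
marginals (Friedli–Velenik 2017, Exercise 3.15: `isingExpect_fixed_mul_of_separated`,
`isingExpect_fixed_eq_of_separated`), the spins off `E` are frozen to `η`, and each single-site
variance is at least `e^{-12β}` (`exp_le_isingExpect_singleton_sq`). [folklore] -/
private theorem condVar_lower {β : ℝ} (hβ : 0 ≤ β) {E Λ : Finset (Site 3)} (hE : E ⊆ Λ)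
    (hind : ∀ x ∈ E, ∀ y ∈ E, ¬(zdGraph 3).Adj x y) (η : SpinConfig (Site 3))
    (f : Site 3 → ℝ) (C : ℝ) :
    Real.exp (-(12 * β)) * (∑ a ∈ E, f a ^ 2) *
        isingPartitionFunction (zdGraph 3) E β 0 (.fixed η) ≤
      ∑ τ : ↥E → ℤˣ, isingWeight (zdGraph 3) E β 0 (.fixed η) τ *
        ((∑ a ∈ Λ, f a * spinAt a (glue E τ (.fixed η))) - C) ^ 2 := by
  set Z := isingPartitionFunction (zdGraph 3) E β 0 (.fixed η) with hZ
  have hZpos : 0 < Z := isingPartitionFunction_pos _ _ _ _ _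
  set w : (↥E → ℤˣ) → ℝ := isingWeight (zdGraph 3) E β 0 (.fixed η) with hw
  set p : (↥E → ℤˣ) → ℝ := fun τ => w τ / Z with hp
  have hp0 : ∀ τ, 0 ≤ p τ := fun τ =>
    div_nonneg (isingWeight_pos (zdGraph 3) E β 0 (.fixed η) τ).le hZpos.le
  have hp1 : ∑ τ, p τ = 1 := by
    simp only [hp]; rw [← Finset.sum_div, div_eq_one_iff_eq hZpos.ne']; rfl
  have hwp : ∀ τ, w τ = Z * p τ := fun τ => by simp only [hp]; field_simp
  -- spins, conditional means, and finite-volume expectations on `E` as `p`-weighted sums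
  set s : Site 3 → (↥E → ℤˣ) → ℝ := fun a τ => spinAt a (glue E τ (.fixed η)) with hs
  set m : Site 3 → ℝ := fun a => ∑ τ, p τ * s a τ with hm
  have hEx : ∀ {g : SpinConfig (Site 3) → ℝ}, Measurable g →
      isingExpect (zdGraph 3) E β 0 (.fixed η) g = ∑ τ, p τ * g (glue E τ (.fixed η)) := by
    intro g hg; rw [isingExpect_eq_sum_div (zdGraph 3) E 0 (.fixed η) β hg, Finset.sum_div]
    exact Finset.sum_congr rfl fun τ _ => by simp only [hp]; ring
  -- separation of a site of `E` from the rest of `E`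
  have hsub : ∀ a ∈ E, ({a} : Finset (Site 3)) ⊆ E := fun a => Finset.singleton_subset_iff.2
  have hsep : ∀ a ∈ E, ∀ x ∈ ({a} : Finset (Site 3)), ∀ y ∈ E \ {a}, ¬(zdGraph 3).Adj x y :=
    fun a ha x hx y hy => by
      rw [Finset.mem_singleton.1 hx]; exact hind a ha y (Finset.mem_sdiff.1 hy).1
  have hloc : ∀ a, ∀ σ σ' : SpinConfig (Site 3), (∀ x ∈ ({a} : Finset (Site 3)), σ x = σ' x) →
      spinAt a σ = spinAt a σ' := fun a σ σ' h => by
    simp only [spinAt, h a (Finset.mem_singleton_self a)]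
  -- (i) distinct sites of `E` are uncorrelated
  have hindep : ∀ a ∈ E, ∀ b ∈ E, a ≠ b → ∑ τ, p τ * (s a τ * s b τ) = m a * m b := by
    intro a ha b hb hab
    have hgb : ∀ σ σ' : SpinConfig (Site 3), (∀ x ∈ E \ {a}, σ x = σ' x) →
        spinAt b σ = spinAt b σ' := fun σ σ' h => by
      have hb' : b ∈ E \ {a} := Finset.mem_sdiff.2 ⟨hb, by rwa [Finset.mem_singleton, eq_comm]⟩
      simp only [spinAt, h b hb']
    have h1 := isingExpect_fixed_mul_of_separated (zdGraph 3) (hsub a ha) (hsep a ha) η β 0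
      (measurable_spinAt a) (measurable_spinAt b) (hloc a) hgb
    rw [← isingExpect_fixed_eq_of_separated (zdGraph 3) (hsub a ha) (hsep a ha) η β 0
      (measurable_spinAt a) (hloc a), hEx ((measurable_spinAt a).fun_mul (measurable_spinAt b)),
      hEx (measurable_spinAt a), hEx (measurable_spinAt b)] at h1
    simpa only [hs, hm] using h1
  -- (ii) each site of `E` has conditional variance at least `e^{-12β}`
  have hdiag : ∀ a ∈ E, Real.exp (-(12 * β)) ≤ ∑ τ, p τ * ((s a τ - m a) * (s a τ - m a)) := by
    intro a ha
    have hmeas : Measurable fun σ : SpinConfig (Site 3) => (spinAt a σ - m a) ^ 2 :=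
      ((measurable_spinAt a).sub_const (m a)).pow_const 2
    have hfa : ∀ σ σ' : SpinConfig (Site 3), (∀ x ∈ ({a} : Finset (Site 3)), σ x = σ' x) →
        (spinAt a σ - m a) ^ 2 = (spinAt a σ' - m a) ^ 2 := fun σ σ' h => by rw [hloc a σ σ' h]
    have h := exp_le_isingExpect_singleton_sq hβ a η (m a)
    rw [← isingExpect_fixed_eq_of_separated (zdGraph 3) (hsub a ha) (hsep a ha) η β 0 hmeas hfa,
      hEx hmeas] at h
    simpa only [hs, sq] using h
  -- (iii) the sites off `E` are frozen, so the off-diagonal centred mixed moments vanish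
  have hconst : ∀ a, a ∉ E → ∀ τ, s a τ - m a = 0 := by
    intro a ha τ
    have hval : ∀ τ', s a τ' = spinAt a η := fun τ' => by
      simp only [hs, spinAt, glue_apply_of_notMem _ _ _ ha, BoundaryCondition.outside_fixed]
    simp only [hm, hval, ← Finset.sum_mul, hp1, one_mul, sub_self]
  have hoff : ∀ a ∈ Λ, ∀ b ∈ Λ, a ≠ b →
      ∑ τ, p τ * ((s a τ - m a) * (s b τ - m b)) = 0 := by
    intro a _ b _ hab
    by_cases ha : a ∈ E
    · by_cases hb : b ∈ E
      · have hx : ∀ τ, p τ * ((s a τ - m a) * (s b τ - m b)) = p τ * (s a τ * s b τ)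
            - m b * (p τ * s a τ) - m a * (p τ * s b τ) + m a * m b * p τ := fun τ => by ring
        have hma : ∑ τ, p τ * s a τ = m a := rfl
        have hmb : ∑ τ, p τ * s b τ = m b := rfl
        rw [Finset.sum_congr rfl fun τ _ => hx τ, Finset.sum_add_distrib, Finset.sum_sub_distrib,
          Finset.sum_sub_distrib, ← Finset.mul_sum, ← Finset.mul_sum, ← Finset.mul_sum,
          hindep a ha b hb hab, hma, hmb, hp1]
        ring
      · exact Finset.sum_eq_zero fun τ _ => by rw [hconst b hb τ]; ring
    · exact Finset.sum_eq_zero fun τ _ => by rw [hconst a ha τ]; ring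
  -- assembly: mean square about `C` ≥ variance = Σ_{a∈E} f(a)² Var(σ_a) ≥ e^{-12β} Σ_{a∈E} f(a)²
  set Y : (↥E → ℤˣ) → ℝ := fun τ => ∑ a ∈ Λ, f a * s a τ with hY
  have hYbar : ∑ τ, p τ * Y τ = ∑ a ∈ Λ, f a * m a := by
    simp only [hY, Finset.mul_sum]
    rw [Finset.sum_comm]
    refine Finset.sum_congr rfl fun a _ => ?_
    rw [Finset.mul_sum]; exact Finset.sum_congr rfl fun τ _ => by ring
  have hcen : ∀ τ, Y τ - ∑ τ', p τ' * Y τ' = ∑ a ∈ Λ, f a * (s a τ - m a) := fun τ => by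
    rw [hYbar, hY, ← Finset.sum_sub_distrib]
    exact Finset.sum_congr rfl fun a _ => by ring
  calc Real.exp (-(12 * β)) * (∑ a ∈ E, f a ^ 2) * Z
        = Z * (Real.exp (-(12 * β)) * ∑ a ∈ E, f a ^ 2) := by ring
    _ ≤ Z * ∑ τ, p τ * (∑ a ∈ Λ, f a * (s a τ - m a)) ^ 2 :=
        mul_le_mul_of_nonneg_left
          (wsum_sq_lin_ge hp0 hE f (fun a τ => s a τ - m a) hoff hdiag) hZpos.le
    _ = Z * ∑ τ, p τ * (Y τ - ∑ τ', p τ' * Y τ') ^ 2 := by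
        congr 1; exact Finset.sum_congr rfl fun τ _ => by rw [hcen]
    _ ≤ Z * ∑ τ, p τ * (Y τ - C) ^ 2 := mul_le_mul_of_nonneg_left (wvar_le_wmse hp1 Y C) hZpos.le
    _ = ∑ τ, w τ * (Y τ - C) ^ 2 := by
        rw [Finset.mul_sum]
        exact Finset.sum_congr rfl fun τ _ => by rw [hwp τ]; ring
    _ = ∑ τ, w τ * ((∑ a ∈ Λ, f a * spinAt a (glue E τ (.fixed η))) - C) ^ 2 := by
        simp only [hY, hs]

/-- **Law of total variance over an independent set, for the critical `+` box.** For `E ⊆ Λ_L`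
with no edge of `ℤ³` inside `E`, any `f` and `C`:
`e^{-12β_c} (Σ_{a ∈ E} f(a)²) Z⁺_{Λ_L} ≤ Σ_τ w⁺_{Λ_L}(τ) (Σ_{a ∈ Λ_L} f(a) σ_a − C)²`: the DLR
decomposition `sum_isingWeight_fixed_eq_sum_sum` / `isingPartitionFunction_fixed_eq_sum`
(Friedli–Velenik 2017, Lemma 6.7), then `condVar_lower` for each exterior pattern. [folklore] -/
private theorem var_lower_of_independent (L : ℕ) {E : Finset (Site 3)} (hE : E ⊆ box 3 L)
    (hind : ∀ x ∈ E, ∀ y ∈ E, ¬(zdGraph 3).Adj x y) (f : Site 3 → ℝ) (C : ℝ) :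
    Real.exp (-(12 * criticalBeta 3)) * (∑ a ∈ E, f a ^ 2) *
        isingPartitionFunction (zdGraph 3) (box 3 L) (criticalBeta 3) 0 .plus ≤
      ∑ τ : ↥(box 3 L) → ℤˣ, isingWeight (zdGraph 3) (box 3 L) (criticalBeta 3) 0 .plus τ *
        ((∑ a ∈ box 3 L, f a * spinAt a (glue (box 3 L) τ .plus)) - C) ^ 2 := by
  have hZ := isingPartitionFunction_fixed_eq_sum (zdGraph 3) hE (1 : SpinConfig (Site 3))
    (criticalBeta 3) 0
  have hS := sum_isingWeight_fixed_eq_sum_sum (zdGraph 3) hE (1 : SpinConfig (Site 3))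
    (criticalBeta 3) 0 (fun σ => ((∑ a ∈ box 3 L, f a * spinAt a σ) - C) ^ 2)
  change isingPartitionFunction (zdGraph 3) (box 3 L) (criticalBeta 3) 0 .plus = _ at hZ
  change ∑ τ : ↥(box 3 L) → ℤˣ, isingWeight (zdGraph 3) (box 3 L) (criticalBeta 3) 0 .plus τ *
    ((∑ a ∈ box 3 L, f a * spinAt a (glue (box 3 L) τ .plus)) - C) ^ 2 = _ at hS
  rw [hZ, hS, Finset.mul_sum]
  refine Finset.sum_le_sum fun τ₂ _ => ?_
  rw [mul_left_comm]
  exact mul_le_mul_of_nonneg_left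
    (condVar_lower (criticalBeta_nonneg 3) hE hind _ f C) (Real.exp_pos _).le

/-! ### The stub -/

/-- **Stub `stub_covUniformPD`** (registered signature, verbatim): UNIFORM POSITIVE-DEFINITENESS
of the covariance matrix of the critical `+` box, `fᵀ K_L f = Var⁺_{Λ_L}(Σ_a f(a)σ_a) ≥ c Σ_a f(a)²`
with `c = e^{-12β_c(3)}/2` independent of `L` (law of total variance over the even and the odd
sublattice). [folklore] -/
theorem stub_covUniformPD : ∃ c : ℝ, 0 < c ∧ ∀ (L : ℕ) (f : ↥(box 3 L) → ℝ),
    c * ∑ a, f a ^ 2 ≤ ∑ a, ∑ b, f a * covMat L (box 3 L) a b * f b := by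
  refine ⟨Real.exp (-(12 * criticalBeta 3)) / 2, by positivity, fun L f => ?_⟩
  -- the plus state as a finite probability vector (as in the torsion file)
  have hZpos := isingPartitionFunction_pos (zdGraph 3) (box 3 L) (criticalBeta 3) 0 .plus
  have hw1 : ∑ τ, plusProb L τ = 1 := by
    unfold plusProb; rw [← Finset.sum_div, div_eq_one_iff_eq hZpos.ne']; rfl
  have hplusE : ∀ {g : SpinConfig (Site 3) → ℝ}, Measurable g →
      plusE L g = ∑ τ, plusProb L τ * g (glue (box 3 L) τ .plus) := fun hg => by
    unfold plusE plusProb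
    rw [isingExpect_eq_sum_div _ _ _ _ _ hg, Finset.sum_div]
    exact Finset.sum_congr rfl fun τ _ => by ring
  -- centred spins `t_x = σ_x − ⟨σ_x⟩⁺` and the covariance as their Gram matrix
  set s : Site 3 → (↥(box 3 L) → ℤˣ) → ℝ := fun x τ => spinAt x (glue (box 3 L) τ .plus) with hs
  set t : Site 3 → (↥(box 3 L) → ℤˣ) → ℝ := fun x τ => s x τ - plusE L (spinAt x) with ht
  have hμ : ∀ x, ∑ τ, plusProb L τ * s x τ = plusE L (spinAt x) := fun x =>
    (hplusE (measurable_spinAt x)).symm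
  have hG : ∀ x y, cov L x y = ∑ τ, plusProb L τ * (t x τ * t y τ) := by
    intro x y
    have h2 : ∀ τ, plusProb L τ * (t x τ * t y τ) = plusProb L τ * (s x τ * s y τ)
        - plusE L (spinAt y) * (plusProb L τ * s x τ) - plusE L (spinAt x) * (plusProb L τ * s y τ)
        + plusE L (spinAt x) * plusE L (spinAt y) * plusProb L τ := fun τ => by
      simp only [ht]; ring
    unfold cov
    rw [hplusE ((measurable_spinAt x).fun_mul (measurable_spinAt y)),
      Finset.sum_congr rfl fun τ _ => h2 τ, Finset.sum_add_distrib, Finset.sum_sub_distrib,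
      Finset.sum_sub_distrib, ← Finset.mul_sum, ← Finset.mul_sum, ← Finset.mul_sum, hμ, hμ, hw1]
    ring
  -- the quadratic form of `K_L` is the variance of the linear statistic `Σ_a f(a) σ_a`
  have hquad : ∑ a, ∑ b, f a * covMat L (box 3 L) a b * f b =
      ∑ τ, plusProb L τ * (∑ a, f a * t a τ) ^ 2 := by
    rw [wsum_sq_lin (plusProb L) Finset.univ f fun a : ↥(box 3 L) => t a]
    refine Finset.sum_congr rfl fun a _ => Finset.sum_congr rfl fun b _ => ?_
    simp only [covMat, Matrix.of_apply]; rw [hG]; ring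
  -- extension of `f` by zero, the centring constant, and the variance as a Boltzmann sum
  set fV : Site 3 → ℝ := fun x => if hx : x ∈ box 3 L then f ⟨x, hx⟩ else 0 with hfV
  have hfVa : ∀ a : ↥(box 3 L), fV a = f a := fun a => by simp only [hfV]; exact dif_pos a.2
  set C : ℝ := ∑ x ∈ box 3 L, fV x * plusE L (spinAt x) with hC
  have hlin : ∀ τ, ∑ a, f a * t a τ =
      (∑ x ∈ box 3 L, fV x * spinAt x (glue (box 3 L) τ .plus)) - C := fun τ => by
    rw [hC, ← Finset.sum_coe_sort (box 3 L) (fun x => fV x * spinAt x (glue (box 3 L) τ .plus)),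
      ← Finset.sum_coe_sort (box 3 L) (fun x => fV x * plusE L (spinAt x)),
      ← Finset.sum_sub_distrib]
    exact Finset.sum_congr rfl fun a _ => by rw [hfVa a]; simp only [ht, hs]; ring
  have hsq : ∑ a, f a ^ 2 = ∑ x ∈ box 3 L, fV x ^ 2 := by
    rw [← Finset.sum_coe_sort (box 3 L) (fun x => fV x ^ 2)]
    exact Finset.sum_congr rfl fun a _ => by rw [hfVa a]
  have hvar : ∑ τ, plusProb L τ * (∑ a, f a * t a τ) ^ 2 =
      (∑ τ, isingWeight (zdGraph 3) (box 3 L) (criticalBeta 3) 0 .plus τ *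
        ((∑ x ∈ box 3 L, fV x * spinAt x (glue (box 3 L) τ .plus)) - C) ^ 2) /
        isingPartitionFunction (zdGraph 3) (box 3 L) (criticalBeta 3) 0 .plus := by
    rw [Finset.sum_div]
    exact Finset.sum_congr rfl fun τ _ => by rw [hlin]; unfold plusProb; ring
  -- the even and the odd sublattices are independent sets covering the box
  set Ev : Finset (Site 3) := (box 3 L).filter fun x => Even (∑ i, x i) with hEv
  set Od : Finset (Site 3) := (box 3 L).filter fun x => ¬Even (∑ i, x i) with hOd
  have hindEv : ∀ x ∈ Ev, ∀ y ∈ Ev, ¬(zdGraph 3).Adj x y := fun x hx y hy hadj =>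
    (even_iff_not_even_of_adj hadj).1 (Finset.mem_filter.1 hx).2 (Finset.mem_filter.1 hy).2
  have hindOd : ∀ x ∈ Od, ∀ y ∈ Od, ¬(zdGraph 3).Adj x y := fun x hx y hy hadj =>
    (Finset.mem_filter.1 hy).2 (Classical.byContradiction fun h => (Finset.mem_filter.1 hx).2
      ((even_iff_not_even_of_adj hadj).2 h))
  have hsplit : ∑ x ∈ box 3 L, fV x ^ 2 = ∑ x ∈ Ev, fV x ^ 2 + ∑ x ∈ Od, fV x ^ 2 :=
    (Finset.sum_filter_add_sum_filter_not _ _ _).symm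
  have h1 := var_lower_of_independent L (Finset.filter_subset _ _) hindEv fV C
  have h2 := var_lower_of_independent L (Finset.filter_subset _ _) hindOd fV C
  rw [hquad, hvar, hsq, hsplit, le_div_iff₀ hZpos]
  linarith [h1, h2]

end Summit.CriticalPhenomena.Ising3DConformalLimit.PlantedPinningGaussianPinningSaturation

end
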